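import Mathlib
import HarnessLib
import Literature.Analysis.FluidPDE.VectorCalculus
import Literature.Analysis.FluidPDE.Vorticity
import Literature.Analysis.FluidPDE.LocalTypeI
import Literature.Analysis.FluidPDE.CollapseDebris
import Summits.NavierStokesRegularity.NavierStokesRegularity.Theses.LocalSineTubeDoor
import Summits.NavierStokesRegularity.NavierStokesRegularity.Theorems.LocalSineTubeDoorLocalPointZoom
import Summits.NavierStokesRegularity.NavierStokesRegularity.Theorems.LocalSineTubeDoorProfileAlignedWindowRigidity

/-!
# Route `LocalSineTubeDoor` — the LOCAL CROSS TUBE DOOR (aside corollary `LocalTubeDoorCross` of K1 ∧ K2), unconditional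

Cell ns-regularity-ideate, seat p6 (route-directed support, `--supports stmt-NavierStokesRegularity-20017`). DIRECTOR-NS
2026-08-25T21:32:52Z banked the cross door as an ASIDE corollary of the route's cruxes K1 `LocalPointZoom` (stmt-…-20017) and K2
`ProfileAlignedWindowRigidity` (stmt-…-20018) — «same mechanism, not a second route»; both cruxes are tree theorems
(`…Theorems.LocalSineTubeDoorLocalPointZoom.localPointZoom_proof`, `…Theorems.LocalSineTubeDoorProfileAlignedWindowRigidity.
profileAlignedWindowRigidity_proof`), so the corollary is an UNCONDITIONAL theorem. Statement = nsreg-p1's kernel-certified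
`route/aside-cross/signature-LocalTubeDoorCross.txt` VERBATIM; proof = nsreg-p1's two-point Fatou passage `route-cross/glue-target.lean`
(`closes`, 0 sorries) with the two cruxes plugged in: along the zoom times of K1 the window field `(T−tⱼ)·ω(tⱼ, x₀+√(T−tⱼ)y)` converges
pointwise to the continuous `ω∞((√ν)⁻¹y)`; Fatou gives `∫∫_{U×U}‖ω∞×ω∞′‖ = 0`, so `ω∞` is parallel to one non-zero vector on
`(√ν)⁻¹U`, and K2 forces `v ≡ 0`, contradicting the singular apex.

* `localTubeDoorCross` — classical Leray–Hopf solution from a rapidly decaying datum, LOCALLY Type I at `(x₀,T)` on one parabolic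
  cylinder; if on ONE nonempty open similarity window `U` the scale-critical two-point cross defect
  `∫∫_{U×U} ‖(T−t)ω(t,x₀+√(T−t)y) × (T−t)ω(t,x₀+√(T−t)y′)‖ → 0` as `t → T⁻`, then `u` is backward bounded at `(x₀,T)`.

WHAT THIS IS NOT: not a claim about Navier–Stokes regularity (Clay A) — a regularity CRITERION (local Type I + fading two-point
vorticity-direction defect on one window), a banked corollary of the door rung N0-LocalTubeDoorSine; establishment in the cell's
sense still requires the cross-family referee PASS + independent reproduction.
-/

noncomputable section

-- the summit and its single sub-problem share the name (CONVENTIONS §1), as in every Theorems file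
set_option linter.dupNamespace false

namespace Summit.NavierStokesRegularity.NavierStokesRegularity.Theorems.LocalSineTubeDoorCrossDoor

open MeasureTheory Set Function Filter Topology TopologicalSpace Metric
open scoped RealInnerProductSpace InnerProductSpace ENNReal

/-- **The LOCAL CROSS TUBE DOOR** (aside `LocalTubeDoorCross` of route LocalSineTubeDoor; nsreg-p1 ROUND-6): local Type I at
`(x₀,T)` plus a fading scale-critical two-point cross defect of the vorticity on ONE similarity window force backward boundedness.
Unconditional: K1 and K2 of the route are tree theorems. -/
theorem localTubeDoorCross :
    ∀ (ν T : ℝ), 0 < ν → 0 < T → ∀ (u : ℝ → EuclideanSpace ℝ (Fin 3) → EuclideanSpace ℝ (Fin 3)) (p : ℝ → EuclideanSpace ℝ (Fin 3) → ℝ), Literature.Analysis.FluidPDE.IsClassicalNSSolutionOn (Set.Ico 0 T) ν 0 u p → Literature.Analysis.FluidPDE.IsLerayHopfOn T ν 0 (u 0) u → Literature.Analysis.FluidPDE.HasRapidSpatialDecay (u 0) → ∀ (x₀ : EuclideanSpace ℝ (Fin 3)) (ρ M : ℝ), 0 < ρ → (∀ t ∈ Set.Ico 0 T, T - ρ ^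 2 < t → ∀ x ∈ Metric.ball x₀ ρ, ‖u t x‖ * Real.sqrt (ν * (T - t)) ≤ M) → ∀ (U : Set (EuclideanSpace ℝ (Fin 3))), IsOpen U → U.Nonempty → Filter.Tendsto (fun t : ℝ => ∫⁻ q in U ×ˢ U, ENNReal.ofReal ‖Literature.Analysis.FluidPDE.cross ((T - t) • Literature.Analysis.FluidPDE.curl (u t) (x₀ + Real.sqrt (T - t) • q.1)) ((T - t) • Literature.Analysis.FluidPDE.curl (u t) (x₀ + Real.sqrt (T - t) • q.2))‖) (nhdsWithin T (Set.Iio T)) (nhds 0) → Literature.Analysis.FluidPDE.IsBackwardBoundedAt u T x₀ := by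
  have h₁ := Summit.NavierStokesRegularity.NavierStokesRegularity.Theorems.LocalSineTubeDoorLocalPointZoom.localPointZoom_proof
  have h₂ := Summit.NavierStokesRegularity.NavierStokesRegularity.Theorems.LocalSineTubeDoorProfileAlignedWindowRigidity.profileAlignedWindowRigidity_proof
  unfold Summit.NavierStokesRegularity.NavierStokesRegularity.Theses.LocalSineTubeDoor.LocalPointZoom at h₁
  unfold Summit.NavierStokesRegularity.NavierStokesRegularity.Theses.LocalSineTubeDoor.ProfileAlignedWindowRigidity at h₂
  intro ν T hν hT u p hcl hLH hdec x₀ ρ M hρ hM U hU hUne hfade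
  by_contra hnot
  obtain ⟨C, v, lam, hlam, hlam0, ⟨hrate, hcont, hmild, hdiv⟩, hsing, hconv⟩ :=
    h₁ ν T hν hT u p hcl hLH hdec x₀ ρ M hρ hM hnot
  obtain ⟨hω, hrig⟩ := h₂ C v hrate hcont hmild hdiv
  -- elementary facts about the Literature.Analysis.FluidPDE.cross product
  have cross_smul_left : ∀ (c : ℝ) (a b : EuclideanSpace ℝ (Fin 3)),
      Literature.Analysis.FluidPDE.cross (c • a) b = c • Literature.Analysis.FluidPDE.cross a b := by
    intro c a b; simp only [← Literature.Analysis.FluidPDE.crossCLM_apply, map_smul]; rfl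
  have cross_zero_left : ∀ e : EuclideanSpace ℝ (Fin 3), Literature.Analysis.FluidPDE.cross 0 e = 0 := by
    intro e; simpa using cross_smul_left 0 e e
  have norm_cross_le : ∀ a b : EuclideanSpace ℝ (Fin 3), ‖Literature.Analysis.FluidPDE.cross a b‖ ≤ ‖a‖ * ‖b‖ := by
    intro a b; rw [Literature.Analysis.FluidPDE.norm_cross]
    exact mul_le_of_le_one_right (mul_nonneg (norm_nonneg _) (norm_nonneg _)) (Real.sin_le_one _)
  have norm_cross_sub_cross_le : ∀ x y a b : EuclideanSpace ℝ (Fin 3),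
      ‖Literature.Analysis.FluidPDE.cross x y - Literature.Analysis.FluidPDE.cross a b‖ ≤ ‖x - a‖ * ‖y‖ + ‖a‖ * ‖y - b‖ := by
    intro x y a b
    have h : Literature.Analysis.FluidPDE.cross x y - Literature.Analysis.FluidPDE.cross a b = Literature.Analysis.FluidPDE.cross (x - a) y + Literature.Analysis.FluidPDE.cross a (y - b) := by
      have h1 : Literature.Analysis.FluidPDE.cross (x - a) y = Literature.Analysis.FluidPDE.cross x y - Literature.Analysis.FluidPDE.cross a y := by
        simp only [← Literature.Analysis.FluidPDE.crossCLM_apply, map_sub, sub_apply]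
      have h2 : Literature.Analysis.FluidPDE.cross a (y - b) = Literature.Analysis.FluidPDE.cross a y - Literature.Analysis.FluidPDE.cross a b := by
        simp only [← Literature.Analysis.FluidPDE.crossCLM_apply, map_sub]
      rw [h1, h2]; abel
    rw [h]
    exact (norm_add_le _ _).trans (add_le_add (norm_cross_le _ _) (norm_cross_le _ _))
  have tendsto_cross : ∀ {f g : ℕ → EuclideanSpace ℝ (Fin 3)} {a b : EuclideanSpace ℝ (Fin 3)},
      Tendsto f atTop (𝓝 a) → Tendsto g atTop (𝓝 b) →
      Tendsto (fun n => Literature.Analysis.FluidPDE.cross (f n) (g n)) atTop (𝓝 (Literature.Analysis.FluidPDE.cross a b)) := by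
    intro f g a b hf hg
    rw [tendsto_iff_norm_sub_tendsto_zero]
    have hf' : Tendsto (fun n => ‖f n - a‖) atTop (𝓝 0) := tendsto_iff_norm_sub_tendsto_zero.1 hf
    have hg' : Tendsto (fun n => ‖g n - b‖) atTop (𝓝 0) := tendsto_iff_norm_sub_tendsto_zero.1 hg
    have h1 : Tendsto (fun n => ‖f n - a‖ * ‖g n‖ + ‖a‖ * ‖g n - b‖) atTop (𝓝 0) := by
      simpa using (hf'.mul hg.norm).add (hg'.const_mul ‖a‖)
    exact squeeze_zero (fun n => norm_nonneg _) (fun n => norm_cross_sub_cross_le _ _ _ _) h1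
  have continuous_cross₂ : Continuous fun q : EuclideanSpace ℝ (Fin 3) × EuclideanSpace ℝ (Fin 3) =>
      Literature.Analysis.FluidPDE.cross q.1 q.2 :=
    Literature.Analysis.FluidPDE.crossCLM.continuous₂
  -- a profile vanishing on the open backward slab is not backward-singular at the apex
  have not_sing_of_zero : (∀ t < 0, ∀ y, v t y = 0) → ¬ Literature.Analysis.FluidPDE.IsBackwardSingularPoint v 0 := by
    intro hzero hs
    have h1 := hs 1 one_pos
    have hmeas : MeasurableSet (Literature.Analysis.FluidPDE.parabolicCylinder 1 (0 : ℝ × EuclideanSpace ℝ (Fin 3))) :=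
      show MeasurableSet (Ioo _ _ ×ˢ Metric.ball _ _) from measurableSet_Ioo.prod measurableSet_ball
    have hle : eLpNorm (uncurry v) ⊤
        (volume.restrict (Literature.Analysis.FluidPDE.parabolicCylinder 1 (0 : ℝ × EuclideanSpace ℝ (Fin 3)))) ≤
        ENNReal.ofReal 0 := by
      rw [eLpNorm_exponent_top]
      refine eLpNormEssSup_le_of_ae_bound ((ae_restrict_iff' hmeas).2 (Eventually.of_forall ?_))
      intro z hz
      have hz' : z ∈ Ioo ((0 : ℝ × EuclideanSpace ℝ (Fin 3)).1 - 1 ^ 2)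
          (0 : ℝ × EuclideanSpace ℝ (Fin 3)).1 ×ˢ Metric.ball (0 : ℝ × EuclideanSpace ℝ (Fin 3)).2 1 := hz
      have hz0 : z.1 < 0 := by simpa using (mem_prod.1 hz').1.2
      show ‖v z.1 z.2‖ ≤ 0
      rw [hzero z.1 hz0 z.2, norm_zero]
    exact absurd h1 (hle.trans_lt ENNReal.ofReal_lt_top).ne
  -- zoom bookkeeping
  have h10 : (-1 : ℝ) < 0 := by norm_num
  set c : ℕ → ℝ := fun j => lam j ^ 2 / ν with hc_def
  have hc : ∀ j, 0 < c j := fun j => div_pos (pow_pos (hlam j) 2) hν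
  have hc0 : Tendsto c atTop (𝓝 0) := by
    simpa [hc_def] using (hlam0.pow 2).div_const ν
  have hsν : 0 < Real.sqrt ν := Real.sqrt_pos.2 hν
  -- zoom times `tⱼ = T − λⱼ²/ν → T⁻`, and the defect along them
  set t : ℕ → ℝ := fun j => T - c j with ht
  have htT : Tendsto t atTop (𝓝[<] T) := by
    refine tendsto_nhdsWithin_iff.2 ⟨?_, Eventually.of_forall fun j => ?_⟩
    · simpa [ht] using (tendsto_const_nhds (x := T)).sub hc0
    · show T - c j < T
      linarith [hc j]
  have hfadej := hfade.comp htT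
  -- the window fields along the zoom, `W j y = (T − tⱼ) • ω(tⱼ, x₀ + √(T−tⱼ) y)`
  set W : ℕ → EuclideanSpace ℝ (Fin 3) → EuclideanSpace ℝ (Fin 3) :=
    fun j y => (T - t j) • Literature.Analysis.FluidPDE.curl (u (t j)) (x₀ + Real.sqrt (T - t j) • y) with hWdef
  have hfadeW : Tendsto (fun j => ∫⁻ q in U ×ˢ U,
      ENNReal.ofReal ‖Literature.Analysis.FluidPDE.cross (W j q.1) (W j q.2)‖) atTop (𝓝 0) := hfadej
  have hWm : ∀ j, Measurable (W j) := by
    intro j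
    have hφ : Continuous fun y : EuclideanSpace ℝ (Fin 3) => x₀ + Real.sqrt (T - t j) • y :=
      continuous_const.add (continuous_const_smul _)
    exact ((Literature.Analysis.FluidPDE.measurable_curl (u (t j))).comp hφ.measurable).const_smul (T - t j)
  have hx : ∀ (j : ℕ) (z : EuclideanSpace ℝ (Fin 3)),
      x₀ + Real.sqrt (T - t j) • (Real.sqrt ν • z) = x₀ + lam j • z := by
    intro j z
    have hsq : Real.sqrt (T - t j) = lam j / Real.sqrt ν := by
      rw [show T - t j = c j by simp [ht], hc_def]
      simp only
      rw [Real.sqrt_div' _ hν.le, Real.sqrt_sq (hlam j).le]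
    rw [hsq, smul_smul, div_mul_cancel₀ _ hsν.ne']
  have hW : ∀ (j : ℕ) (y : EuclideanSpace ℝ (Fin 3)), W j y =
      (lam j ^ 2 / ν) • Literature.Analysis.FluidPDE.curl (u (T - lam j ^ 2 / ν)) (x₀ + lam j • ((Real.sqrt ν)⁻¹ • y)) := by
    intro j y
    have hy : y = Real.sqrt ν • ((Real.sqrt ν)⁻¹ • y) := by
      rw [smul_smul, mul_inv_cancel₀ hsν.ne', one_smul]
    have h1 : T - t j = lam j ^ 2 / ν := by simp [ht, hc_def]
    simp only [hWdef]
    rw [h1]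
    conv_lhs => rw [hy]
    rw [← h1, hx j, h1]
  set ωU : EuclideanSpace ℝ (Fin 3) → EuclideanSpace ℝ (Fin 3) :=
    fun y => Literature.Analysis.FluidPDE.curl (v (-1)) ((Real.sqrt ν)⁻¹ • y) with hωU
  have hωUc : Continuous ωU := hω.comp (continuous_const_smul _)
  have hconvU : ∀ y, Tendsto (fun j => W j y) atTop (𝓝 (ωU y)) := by
    intro y
    simpa only [hW] using hconv ((Real.sqrt ν)⁻¹ • y)
  -- FATOU: the limit field has identically vanishing two-point cross products on `U × U`
  set g : EuclideanSpace ℝ (Fin 3) × EuclideanSpace ℝ (Fin 3) → ENNReal :=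
    fun q => ENNReal.ofReal ‖Literature.Analysis.FluidPDE.cross (ωU q.1) (ωU q.2)‖ with hg
  have hgc : Continuous g :=
    ENNReal.continuous_ofReal.comp
      ((continuous_cross₂.comp ((hωUc.comp continuous_fst).prodMk (hωUc.comp continuous_snd))).norm)
  have hgjm : ∀ j, Measurable fun q : EuclideanSpace ℝ (Fin 3) × EuclideanSpace ℝ (Fin 3) =>
      ENNReal.ofReal ‖Literature.Analysis.FluidPDE.cross (W j q.1) (W j q.2)‖ :=
    fun j => ENNReal.measurable_ofReal.comp
      ((continuous_cross₂.measurable.comp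
        (((hWm j).comp measurable_fst).prodMk ((hWm j).comp measurable_snd))).norm)
  have hptw : ∀ q : EuclideanSpace ℝ (Fin 3) × EuclideanSpace ℝ (Fin 3),
      Tendsto (fun j => ENNReal.ofReal ‖Literature.Analysis.FluidPDE.cross (W j q.1) (W j q.2)‖) atTop (𝓝 (g q)) :=
    fun q => ENNReal.tendsto_ofReal (tendsto_cross (hconvU q.1) (hconvU q.2)).norm
  have hF : ∫⁻ q in U ×ˢ U, liminf (fun j => ENNReal.ofReal ‖Literature.Analysis.FluidPDE.cross (W j q.1) (W j q.2)‖) atTop ≤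
      liminf (fun j => ∫⁻ q in U ×ˢ U, ENNReal.ofReal ‖Literature.Analysis.FluidPDE.cross (W j q.1) (W j q.2)‖) atTop :=
    lintegral_liminf_le' (fun j => (hgjm j).aemeasurable)
  have hlim : (fun q : EuclideanSpace ℝ (Fin 3) × EuclideanSpace ℝ (Fin 3) =>
      liminf (fun j => ENNReal.ofReal ‖Literature.Analysis.FluidPDE.cross (W j q.1) (W j q.2)‖) atTop) = g :=
    funext fun q => (hptw q).liminf_eq
  rw [hlim, hfadeW.liminf_eq] at hF
  have hint : ∫⁻ q in U ×ˢ U, g q = 0 := le_antisymm hF bot_le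
  have hae : ∀ᵐ q ∂(volume.restrict (U ×ˢ U)), g q = 0 :=
    (lintegral_eq_zero_iff hgc.measurable).1 hint
  have hmeasU : MeasurableSet (U ×ˢ U) := hU.measurableSet.prod hU.measurableSet
  rw [ae_restrict_iff' hmeasU] at hae
  haveI : (volume : Measure (EuclideanSpace ℝ (Fin 3) × EuclideanSpace ℝ (Fin 3))).IsOpenPosMeasure := by
    rw [Measure.volume_eq_prod]; exact Measure.prod.instIsOpenPosMeasure
  have hzero : ∀ q ∈ U ×ˢ U, g q = 0 := by
    intro q hq
    by_contra hne
    set O : Set (EuclideanSpace ℝ (Fin 3) × EuclideanSpace ℝ (Fin 3)) := (U ×ˢ U) ∩ g ⁻¹' (Ioi 0) with hO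
    have hOo : IsOpen O := (hU.prod hU).inter (isOpen_Ioi.preimage hgc)
    have hO0 : volume O = 0 := by
      rw [measure_eq_zero_iff_ae_notMem]
      filter_upwards [hae] with q' hq'
      rintro ⟨h1, h2⟩
      have := hq' h1
      simp only [mem_preimage, mem_Ioi, this, lt_self_iff_false] at h2
    have hOe : O = ∅ := (hOo.measure_eq_zero_iff volume).1 hO0
    have hqO : q ∈ O := ⟨hq, by simpa [mem_preimage, mem_Ioi, pos_iff_ne_zero] using hne⟩
    rw [hOe] at hqO
    exact hqO
  have hcross : ∀ y ∈ U, ∀ y' ∈ U, Literature.Analysis.FluidPDE.cross (ωU y) (ωU y') = 0 := by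
    intro y hy y' hy'
    have h := hzero (y, y') ⟨hy, hy'⟩
    simp only [hg, ENNReal.ofReal_eq_zero] at h
    exact norm_le_zero_iff.1 h
  -- `ωU` is parallel to ONE fixed non-zero vector on `U`
  have hwin : ∃ e : EuclideanSpace ℝ (Fin 3), e ≠ 0 ∧ ∀ y ∈ U, Literature.Analysis.FluidPDE.cross (ωU y) e = 0 := by
    by_cases hex : ∃ y₀ ∈ U, ωU y₀ ≠ 0
    · obtain ⟨y₀, hy₀, hne⟩ := hex
      exact ⟨ωU y₀, hne, fun y hy => hcross y hy y₀ hy₀⟩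
    · push Not at hex
      refine ⟨EuclideanSpace.single 0 1, ?_, fun y hy => ?_⟩
      · intro h0
        have := congrArg (fun w : EuclideanSpace ℝ (Fin 3) => w 0) h0
        simp at this
      · rw [hex y hy, cross_zero_left]
  obtain ⟨e, he, hal⟩ := hwin
  -- back to zoom coordinates: `V = (√ν)⁻¹ · U`
  set V : Set (EuclideanSpace ℝ (Fin 3)) := (fun z : EuclideanSpace ℝ (Fin 3) => Real.sqrt ν • z) ⁻¹' U with hV
  have hVo : IsOpen V := hU.preimage (continuous_const_smul (Real.sqrt ν))
  have hVne : V.Nonempty := by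
    obtain ⟨u₀, hu₀⟩ := hUne
    refine ⟨(Real.sqrt ν)⁻¹ • u₀, ?_⟩
    show Real.sqrt ν • ((Real.sqrt ν)⁻¹ • u₀) ∈ U
    rwa [smul_smul, mul_inv_cancel₀ hsν.ne', one_smul]
  have halV : ∀ z ∈ V, Literature.Analysis.FluidPDE.cross (Literature.Analysis.FluidPDE.curl (v (-1)) z) e = 0 := by
    intro z hz
    have h := hal (Real.sqrt ν • z) hz
    simp only [hωU, smul_smul, inv_mul_cancel₀ hsν.ne', one_smul] at h
    exact h
  exact not_sing_of_zero (hrig e he V hVo hVne halV) hsing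

end Summit.NavierStokesRegularity.NavierStokesRegularity.Theorems.LocalSineTubeDoorCrossDoor

end
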